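import Summits.Ventures.CertifiedManyBodySolver.Downfold.CellWordPrecedence

/-!
# The «unanimous-branch road» under an `UND:MIXED` primary (deputy-2 PROPOSAL ACCEPTANCE v1.9 §3.3 (f), DRAFT v0.1)

Venture CertifiedManyBodySolver, cell `pub/hubbard-downfold`, seat hubbard-downfold-score-2 (session g9,
2026-08-27T05:5xZ); namespace `Summit.Ventures.CertifiedManyBodySolver.Downfold.UnanimousBranch`. Everything here
is a finite, PROVED statement about one proposed TEXT (hubbard-deputy-2, `PROPOSAL-v19f-unanimous-branch.md`
sha16 ba7b55a2204193cd, 2026-08-27T04:49Z, requested by director-hubbard 04:48:21Z exit (b)); nothing is about a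
material's physics, and the text is NOT in force (it enters no earlier than the first run assembled after the
2026-08-28 freeze run, and only on the director's ruling).

WHAT THIS IS NOT: not the scorer of record (deputy-2 `score.py` v1.8 90fa3153c4e6faab), not a ruling on the
proposal's open points, not a recommendation. It is the kernel companion of score-2's pre-registration PREREG Y70
(`validation/score/PREREG.md`): the regression TWINS U1–U7 stated BEFORE any ruling or branch statement exists, and
the two readings the director must choose between (open point (1): STRICT «every listed branch speaks» vs LOOSE
«every branch that HAS a statement»).

The text, (f)(1)–(4): under a primary `UND:MIXED(…)` a cell may carry a decided word `W ∈ {SC, not}` iff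
(1) `B` = the listed non-UND branch heads, `|B| ≥ 2`; (2) EVERY `b ∈ B` has a statement of record at that cell
yielding a word `W_b` (a box cell word for `1BH/3BE/BI`; the e–ph band rule for `EPH`, which is SILENT inside its own
band; the (e) default «not» for `CI`); (3) all `W_b` are equal — dissent is printed, never resolved by precedence;
(4) the scorer flags W9 on a decided word under `UND:MIXED` whose basis lacks a `branch:<b>` pointer for some `b ∈ B`
(scored as issued), and a certified word under an UND primary stays the H2:C6 reject of v1.8.

PROVED: the strict road decides `w` iff `|B| ≥ 2` and every listed branch says `w` (`strict_eq_decided_iff`); one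
silent listed branch blocks it (`strict_undetermined_of_silent`) — which is why the road decides 0 cells on the
nine §14 maps today (La-214's 1BH/3BE boxes withdrawn under R-y, no cuprate e–ph band: `m13_today_strict`);
dissent blocks both readings (`strict_undetermined_of_dissent`, `loose_undetermined_of_dissent`); strict ⇒ loose
with the same word (`loose_of_strict`); the readings DIFFER exactly in the one-speaker situations, e.g. M13's v1.9
word «UND:MIXED+1BH+3BE+EPH+CI» with only `CI` speaking: strict undetermined, loose «not» (`m13_today_loose`) — the
loose reading re-derives Q-CI-1's (e) default through (f), the strict one does not; with `CI ∈ B` neither reading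
can ever write «SC» (`strict_ne_SC_of_ci`, `loose_ne_SC_of_ci`); `|B| ≤ 1` words (v3 «UND:MIXED+EPH», M40's bare
`UND:MIXED`) have no road under either reading (`no_road_of_length_le_one`). Twins U1–U7 = `u1` … `u7`.
-/

namespace Summit.Ventures.CertifiedManyBodySolver.Downfold

namespace UnanimousBranch

/-- The listed branch heads that can follow an `UND:MIXED` primary in a router word (ROUTER.md v0.6.4 §3 code
grammar: the one-band Hubbard box `1BH`, the three-band Emery box `3BE`, band insulator `BI`, the e–ph branch
`EPH`, the commensurate-insulator annotation `CI`). [folklore] -/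
inductive Branch
  | OneBH | ThreeBE | BI | EPH | CI
  deriving DecidableEq, Repr

/-- A decided cell word. [folklore] -/
inductive CellW
  | SC | not
  deriving DecidableEq, Repr

/-- What one branch says at one cell (T, P, H): SILENT (no statement of record there — or, for `EPH`, the cell lies
inside the branch's own T_c band) or a decided word ((f)(2)). [folklore] -/
inductive Stmt
  | silent | says (w : CellW)
  deriving DecidableEq, Repr

/-- The road's output for the cell: undetermined (reason printed by the producer) or decided. [folklore] -/
inductive Road
  | undetermined | decided (w : CellW)
  deriving DecidableEq, Repr

/-- every branch of the list says `w`. [folklore] -/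
def agreeAll (w : CellW) (B : List Branch) (s : Branch → Stmt) : Bool :=
  B.all fun b => decide (s b = .says w)

/-- the branches of `B` that have a statement at the cell. [folklore] -/
def speakers (B : List Branch) (s : Branch → Stmt) : List Branch :=
  B.filter fun b => decide (s b ≠ .silent)

/-- STRICT reading of (f)(1)–(3) (the proposal's own): `|B| ≥ 2`, EVERY listed branch speaks, all say the same
word. [folklore] -/
def roadStrict (B : List Branch) (s : Branch → Stmt) : Road :=
  if B.length < 2 then .undetermined
  else if agreeAll .SC B s then .decided .SC
  else if agreeAll .not B s then .decided .not
  else .undetermined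

/-- LOOSE reading (the director's parenthesis, open point (1)): `|B| ≥ 2`, at least one listed branch speaks, and
every branch THAT speaks says the same word (silent branches abstain). [folklore] -/
def roadLoose (B : List Branch) (s : Branch → Stmt) : Road :=
  if B.length < 2 then .undetermined
  else if (speakers B s).isEmpty then .undetermined
  else if agreeAll .SC (speakers B s) s then .decided .SC
  else if agreeAll .not (speakers B s) s then .decided .not
  else .undetermined

/-! ## Characterisations -/

/-- On a nonempty list the two unanimity tests exclude each other. [folklore] -/
theorem agreeAll_SC_not_false {B : List Branch} {s : Branch → Stmt} (hB : B ≠ [])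
    (hS : agreeAll .SC B s = true) : agreeAll .not B s = false := by
  obtain ⟨b, hb⟩ := List.exists_mem_of_ne_nil B hB
  simp only [agreeAll, List.all_eq_true, decide_eq_true_eq] at hS
  simp only [agreeAll, List.all_eq_false]
  exact ⟨b, hb, by rw [hS b hb]; simp⟩

/-- The strict road decides `w` iff `|B| ≥ 2` and every listed branch says `w` ((f)(1)+(2)+(3)). [folklore] -/
theorem strict_eq_decided_iff (B : List Branch) (s : Branch → Stmt) (w : CellW) :
    roadStrict B s = .decided w ↔ 2 ≤ B.length ∧ ∀ b ∈ B, s b = .says w := by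
  have key : ∀ w', (agreeAll w' B s = true ↔ ∀ b ∈ B, s b = .says w') := fun w' => by
    simp [agreeAll, List.all_eq_true]
  constructor
  · intro h
    unfold roadStrict at h
    split_ifs at h with h1 h2 h3
    · cases h
      exact ⟨Nat.le_of_not_lt h1, (key .SC).1 h2⟩
    · cases h
      exact ⟨Nat.le_of_not_lt h1, (key .not).1 h3⟩
  · rintro ⟨hlen, hall⟩
    have hB : B ≠ [] := by rintro rfl; simp at hlen
    unfold roadStrict
    cases w with
    | SC =>
      have h2 : agreeAll .SC B s = true := (key .SC).2 hall
      simp [Nat.not_lt.2 hlen, h2]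
    | not =>
      have h3 : agreeAll .not B s = true := (key .not).2 hall
      have h2 : agreeAll .SC B s = false := by
        obtain ⟨b, hb⟩ := List.exists_mem_of_ne_nil B hB
        simp only [agreeAll, List.all_eq_false]
        exact ⟨b, hb, by rw [hall b hb]; simp⟩
      simp [Nat.not_lt.2 hlen, h2, h3]

/-- (f)(2) strict: one SILENT listed branch keeps the cell undetermined, whatever the others say. [folklore] -/
theorem strict_undetermined_of_silent (B : List Branch) (s : Branch → Stmt) {b : Branch} (hb : b ∈ B)
    (hs : s b = .silent) : roadStrict B s = .undetermined := by
  cases h : roadStrict B s with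
  | undetermined => rfl
  | decided w =>
    have := ((strict_eq_decided_iff B s w).1 h).2 b hb
    rw [hs] at this; cases this

/-- (f)(3): printed DISSENT (one branch says SC, another says not) keeps the cell undetermined under the strict
reading … [folklore] -/
theorem strict_undetermined_of_dissent (B : List Branch) (s : Branch → Stmt) {b c : Branch} (hb : b ∈ B)
    (hc : c ∈ B) (hsb : s b = .says .SC) (hsc : s c = .says .not) : roadStrict B s = .undetermined := by
  cases h : roadStrict B s with
  | undetermined => rfl
  | decided w =>
    have hall := ((strict_eq_decided_iff B s w).1 h).2
    have h1 := hall b hb; have h2 := hall c hc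
    rw [hsb] at h1; rw [hsc] at h2
    cases w <;> simp_all

/-- membership in the speaking sub-list. [folklore] -/
theorem mem_speakers {B : List Branch} {s : Branch → Stmt} {b : Branch} :
    b ∈ speakers B s ↔ b ∈ B ∧ s b ≠ .silent := by
  simp [speakers, List.mem_filter]

/-- The loose road decides `w` iff `|B| ≥ 2`, some listed branch speaks, and every speaking branch says `w`.
[folklore] -/
theorem loose_eq_decided_iff (B : List Branch) (s : Branch → Stmt) (w : CellW) :
    roadLoose B s = .decided w ↔
      2 ≤ B.length ∧ speakers B s ≠ [] ∧ ∀ b ∈ speakers B s, s b = .says w := by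
  have key : ∀ w', (agreeAll w' (speakers B s) s = true ↔ ∀ b ∈ speakers B s, s b = .says w') :=
    fun w' => by simp [agreeAll, List.all_eq_true]
  constructor
  · intro h
    unfold roadLoose at h
    split_ifs at h with h1 h0 h2 h3
    · cases h
      exact ⟨Nat.le_of_not_lt h1, by simpa [List.isEmpty_iff] using h0, (key .SC).1 h2⟩
    · cases h
      exact ⟨Nat.le_of_not_lt h1, by simpa [List.isEmpty_iff] using h0, (key .not).1 h3⟩
  · rintro ⟨hlen, hne, hall⟩
    unfold roadLoose
    have h0 : (speakers B s).isEmpty = false := by simpa [List.isEmpty_iff] using hne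
    cases w with
    | SC =>
      have h2 : agreeAll .SC (speakers B s) s = true := (key .SC).2 hall
      simp [Nat.not_lt.2 hlen, h0, h2]
    | not =>
      have h3 : agreeAll .not (speakers B s) s = true := (key .not).2 hall
      have h2 : agreeAll .SC (speakers B s) s = false := agreeAll_SC_not_false hne |> fun f => by
        by_contra hx
        have := f (by simpa using hx)
        rw [h3] at this; cases this
      simp [Nat.not_lt.2 hlen, h0, h2, h3]

/-- STRICT ⇒ LOOSE with the same word (the loose reading decides a superset of cells). [folklore] -/
theorem loose_of_strict (B : List Branch) (s : Branch → Stmt) (w : CellW) (h : roadStrict B s = .decided w) :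
    roadLoose B s = .decided w := by
  obtain ⟨hlen, hall⟩ := (strict_eq_decided_iff B s w).1 h
  have hB : B ≠ [] := by rintro rfl; simp at hlen
  refine (loose_eq_decided_iff B s w).2 ⟨hlen, ?_, fun b hb => hall b (mem_speakers.1 hb).1⟩
  obtain ⟨b, hb⟩ := List.exists_mem_of_ne_nil B hB
  intro hnil
  have : b ∈ speakers B s := mem_speakers.2 ⟨hb, by rw [hall b hb]; simp⟩
  rw [hnil] at this; cases this

/-- … and dissent blocks the loose reading too ((f)(3) is common to both). [folklore] -/
theorem loose_undetermined_of_dissent (B : List Branch) (s : Branch → Stmt) {b c : Branch} (hb : b ∈ B)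
    (hc : c ∈ B) (hsb : s b = .says .SC) (hsc : s c = .says .not) : roadLoose B s = .undetermined := by
  cases h : roadLoose B s with
  | undetermined => rfl
  | decided w =>
    have hall := ((loose_eq_decided_iff B s w).1 h).2.2
    have h1 := hall b (mem_speakers.2 ⟨hb, by rw [hsb]; simp⟩)
    have h2 := hall c (mem_speakers.2 ⟨hc, by rw [hsc]; simp⟩)
    rw [hsb] at h1; rw [hsc] at h2
    cases w <;> simp_all

/-- (f)(1): a word listing at most ONE branch after `UND:MIXED` (v3 Ti/Zr «UND:MIXED+EPH») or none (M40's bare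
`UND:MIXED(…)`, open point (3)) has NO road under either reading. [folklore] -/
theorem no_road_of_length_le_one (B : List Branch) (s : Branch → Stmt) (h : B.length ≤ 1) :
    roadStrict B s = .undetermined ∧ roadLoose B s = .undetermined := by
  have : B.length < 2 := Nat.lt_of_le_of_lt h (by decide)
  simp [roadStrict, roadLoose, this]

/-- `CI`'s branch statement is the (e) default «not» whenever it speaks; with `CI ∈ B` saying «not», the strict
road can never write «SC» … [folklore] -/
theorem strict_ne_SC_of_ci (B : List Branch) (s : Branch → Stmt) (hci : Branch.CI ∈ B)
    (hs : s .CI = .says .not) : roadStrict B s ≠ .decided .SC := by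
  intro h
  have := ((strict_eq_decided_iff B s .SC).1 h).2 _ hci
  rw [hs] at this; cases this

/-- … nor can the loose road. [folklore] -/
theorem loose_ne_SC_of_ci (B : List Branch) (s : Branch → Stmt) (hci : Branch.CI ∈ B)
    (hs : s .CI = .says .not) : roadLoose B s ≠ .decided .SC := by
  intro h
  have := ((loose_eq_decided_iff B s .SC).1 h).2.2 _ (mem_speakers.2 ⟨hci, by rw [hs]; simp⟩)
  rw [hs] at this; cases this

/-! ## The scorer-side checks of (f)(4) (what `score.py` v1.9 can verify without re-deriving box words) -/

/-- What the scorer sees at a decided cell under `UND:MIXED`: the listed branches, which of them carry a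
`branch:<b>:<pointer>` basis item, whether `EPH ∈ B` with the cell INSIDE the column's e–ph band (EPH silent by
(f)(2)), and whether the word claims `certified`. [folklore] -/
structure ScorerView where
  B : List Branch
  ptr : Branch → Bool
  ephInsideBand : Bool
  certified : Bool

/-- H2:C6 (ACCEPTANCE v1.8, unchanged by (f)(4)): a CERTIFIED word under an UND primary is rejected hard.
[folklore] -/
def h2c6 (v : ScorerView) (r : Road) : Bool :=
  match r with
  | .undetermined => false
  | .decided _ => v.certified

/-- W9 under (f)(4) (scored as issued): a decided word under `UND:MIXED` with `|B| < 2`, or lacking a branch pointer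
for some listed branch, or with `EPH` listed while the cell sits inside the e–ph band (the EPH branch is silent
there, so (2) cannot have been met). [folklore] -/
def w9f (v : ScorerView) (r : Road) : Bool :=
  match r with
  | .undetermined => false
  | .decided _ =>
    decide (v.B.length < 2) || !(v.B.all v.ptr) || (decide (Branch.EPH ∈ v.B) && v.ephInsideBand)

/-- An undetermined cell never draws W9 or H2:C6 from (f)(4). [folklore] -/
theorem undetermined_clean (v : ScorerView) : w9f v .undetermined = false ∧ h2c6 v .undetermined = false :=
  ⟨rfl, rfl⟩

/-- A decided word with complete pointers, `|B| ≥ 2`, EPH either unlisted or outside its band, draws no W9.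
[folklore] -/
theorem w9f_false_of_complete (v : ScorerView) (w : CellW) (hlen : 2 ≤ v.B.length)
    (hptr : ∀ b ∈ v.B, v.ptr b = true) (heph : Branch.EPH ∈ v.B → v.ephInsideBand = false) :
    w9f v (.decided w) = false := by
  have h1 : decide (v.B.length < 2) = false := by simp [Nat.not_lt.2 hlen]
  have h2 : v.B.all v.ptr = true := List.all_eq_true.2 hptr
  simp only [w9f, h1, h2, Bool.not_true, Bool.false_or]
  by_cases he : Branch.EPH ∈ v.B
  · simp [he, heph he]
  · simp [he]

/-! ## Confidence class of a road word ((f)(4): lowest class used, capped at screening-grade) -/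

/-- The three confidence classes of the phase-map schema (D-0099), ordered extrapolated < screening < certified.
[folklore] -/
inductive Conf
  | extrapolated | screening | certified
  deriving DecidableEq, Repr

/-- rank of a class. [folklore] -/
def Conf.rank : Conf → Nat
  | .extrapolated => 0
  | .screening => 1
  | .certified => 2

/-- the lower of two classes. [folklore] -/
def Conf.lower (a b : Conf) : Conf := if a.rank ≤ b.rank then a else b

/-- (f)(4): the class of a road word = the lowest class among the branch statements used, CAPPED at
screening-grade (a conjunction of branch boxes is not an order-ceiling instrument ⇒ never certified). [folklore] -/
def roadClass (cs : List Conf) : Conf :=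
  (cs.foldr Conf.lower .certified).lower .screening

/-- A road word is never certified. [folklore] -/
theorem roadClass_ne_certified (cs : List Conf) : roadClass cs ≠ .certified := by
  unfold roadClass
  generalize cs.foldr Conf.lower Conf.certified = c
  cases c <;> decide

/-- All-certified branch statements still give a screening-grade road word; one extrapolated statement drags the
word to extrapolated. [folklore] -/
theorem roadClass_examples : roadClass [.certified, .certified, .certified] = .screening ∧
    roadClass [.certified, .screening] = .screening ∧
    roadClass [.certified, .extrapolated, .screening] = .extrapolated := by decide

/-! ## The regression twins U1–U7 of PREREG Y70 (expectations stated before the text is of record) -/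

/-- the listed branches of a cuprate word «UND:MIXED+1BH+3BE+EPH» (Hg1201 #19, Tl-2201 #34, SLCO #37 …).
[folklore] -/
def bCuprate : List Branch := [.OneBH, .ThreeBE, .EPH]

/-- the listed branches of M13 La₂CuO₄'s v1.9 word «UND:MIXED+1BH+3BE+EPH+CI». [folklore] -/
def bM13 : List Branch := [.OneBH, .ThreeBE, .EPH, .CI]

/-- U1: every listed branch says SC (three pointers, e–ph band ABOVE the cell so EPH says SC). [folklore] -/
def u1 : Branch → Stmt := fun _ => .says .SC
/-- U2: every listed branch says not. [folklore] -/
def u2 : Branch → Stmt := fun _ => .says .not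
/-- U3: EPH silent (cell inside its band), both boxes say not. [folklore] -/
def u3 : Branch → Stmt
  | .EPH => .silent
  | _ => .says .not
/-- U5: dissent — 1BH box says SC, 3BE box and EPH say not. [folklore] -/
def u5 : Branch → Stmt
  | .OneBH => .says .SC
  | _ => .says .not

/-- U1 ⇒ decided SC under both readings (scored TP on a known superconductor's sub-T_c cell). [folklore] -/
theorem u1_decided : roadStrict bCuprate u1 = .decided .SC ∧ roadLoose bCuprate u1 = .decided .SC := by decide

/-- U2 ⇒ decided not under both readings (TN-type cell). [folklore] -/
theorem u2_decided : roadStrict bCuprate u2 = .decided .not ∧ roadLoose bCuprate u2 = .decided .not := by decide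

/-- U3 (the twin that SEPARATES the readings): EPH silent inside its band, boxes say not ⇒ STRICT undetermined (a
decided word there draws W9), LOOSE decided not. [folklore] -/
theorem u3_split : roadStrict bCuprate u3 = .undetermined ∧ roadLoose bCuprate u3 = .decided .not := by decide

/-- U3 scorer side: the issued «not» with all three pointers but the cell inside the e–ph band ⇒ W9 by (f)(4)
strict; the same view with the cell outside the band ⇒ clean. [folklore] -/
theorem u3_w9 : w9f ⟨bCuprate, fun _ => true, true, false⟩ (.decided .not) = true ∧
    w9f ⟨bCuprate, fun _ => true, false, false⟩ (.decided .not) = false := by decide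

/-- U4: a decided word lacking the `branch:3BE` pointer ⇒ W9 (scored as issued). [folklore] -/
theorem u4_w9 : w9f ⟨bCuprate, fun b => decide (b ≠ .ThreeBE), false, false⟩ (.decided .SC) = true := by decide

/-- U5: dissent ⇒ undetermined under both readings (a decided word there is unlicensed). [folklore] -/
theorem u5_undetermined : roadStrict bCuprate u5 = .undetermined ∧ roadLoose bCuprate u5 = .undetermined := by
  decide

/-- U6: a CERTIFIED word under UND:MIXED ⇒ H2:C6 whatever the branches (v1.8 unchanged; regression S79's class);
screening ⇒ no H2:C6. [folklore] -/
theorem u6_h2c6 : h2c6 ⟨bCuprate, fun _ => true, false, true⟩ (.decided .SC) = true ∧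
    h2c6 ⟨bCuprate, fun _ => true, false, false⟩ (.decided .SC) = false := by decide

/-- U7: «UND:MIXED+EPH» (v3 Ti M85 / Zr M86 @0; one listed branch) ⇒ no road even when EPH speaks, and a decided
word there draws W9 by the `|B| < 2` clause. [folklore] -/
theorem u7_no_road : roadStrict [.EPH] u2 = .undetermined ∧ roadLoose [.EPH] u2 = .undetermined ∧
    w9f ⟨[.EPH], fun _ => true, false, false⟩ (.decided .not) = true := by decide

/-! ## Today's state on the §14 nine (why (f) moves 0 cells at adoption: PREREG Y70 (ii)) -/

/-- M13 La₂CuO₄ @0 TODAY under its v1.9 word: the 1BH/3BE boxes are WITHDRAWN under R-y (silent), no cuprate e–ph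
band exists (EPH silent), `CI` speaks «not» by (e). [folklore] -/
def m13Today : Branch → Stmt
  | .CI => .says .not
  | _ => .silent

/-- Strict (the proposal): M13's cells stay undetermined under (f) — their «not» after the freeze comes from (e)
alone (Q-CI-1 (B1)), not from (f). [folklore] -/
theorem m13_today_strict : roadStrict bM13 m13Today = .undetermined := by decide

/-- Loose (open point (1)): the single speaking branch `CI` would decide «not» through (f) — the loose reading
re-derives the (e) default with extra steps («deciding by fiat», deputy-2's objection). [folklore] -/
theorem m13_today_loose : roadLoose bM13 m13Today = .decided .not := by decide

/-- A cuprate without `CI` (Hg1201 #19, Tl-2201 #34a/b/c, SLCO #37) with every branch silent today: no road under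
either reading ⇒ the F22 ceiling is lifted by (f) only IN PRINCIPLE, cell by cell, once ≥ 2 branch statements of
record exist (PREREG Y70 (iv): printed as a CONDITIONAL ceiling, never merged with the router-word ceilings).
[folklore] -/
theorem cuprate_today_no_road : roadStrict bCuprate (fun _ => .silent) = .undetermined ∧
    roadLoose bCuprate (fun _ => .silent) = .undetermined := by decide

/-- With `CI` listed, no reading of (f) can ever produce «SC» on M13's column (CI's statement is «not» whenever it
speaks) — (f) cannot manufacture a positive on a commensurate parent. [folklore] -/
theorem m13_never_SC (s : Branch → Stmt) (hs : s .CI = .says .not) :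
    roadStrict bM13 s ≠ .decided .SC ∧ roadLoose bM13 s ≠ .decided .SC :=
  ⟨strict_ne_SC_of_ci bM13 s (by decide) hs, loose_ne_SC_of_ci bM13 s (by decide) hs⟩

end UnanimousBranch

end Summit.Ventures.CertifiedManyBodySolver.Downfold
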